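/-
Copyright (c) 2026 the pub-hodgecm-mathlib formalisation cell (harness21).  Prover seat hodgecm-mathlib-K2E3-p23 (g7) (L1 DEAL, LEAD F0P6-plan (g14) BATCH #124 (2);
F4 lead K2Liu-p27 (g2) WORD 23:13:35Z «(E-e) SHRINKS to the Hermite ∕ `vacScalar` bookkeeping»), Track B «K2-LIT» ∕ hLiu418, organ F4 (G-gen), road (E), brick (E-e).
THEOREMS ONLY.
-/
import Summits.HodgeConjecture.HodgeConjecture.Theorems.K2LiuWeilDatumFockStabilityU22     -- ★ `κOp_binvPi` (the frame operators act on `B⁻¹F` by the twisted substitution) (+ ★ `κOp`, `vacScalar`, `dualPairι`, `linSubst`, `binvPi`, `hermitePi`)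
import Summits.HodgeConjecture.HodgeConjecture.Theorems.K2LiuArchPlaceSecFockDegree       -- ★ `binvPi_mem_span_hermitePi` (`B⁻¹F` is a finite Hermite combination)
import Literature.Analysis.SegalBargmann.SchwartzIsotypicFockPolynomials                   -- ★ `binvPi_injective`
import HarnessLib

/-!
# Crux `HLiu418`, organ F4 (G-gen), road (E), brick (E-e): «`K̃`-FINITE + `K_H`-INVARIANT SCHWARTZ VECTOR = (TWISTED-)INVARIANT POLYNOMIAL · φ°» —
# the Hermite ∕ `vacScalar` bookkeeping between the Schrödinger side and the Fock polynomial ring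

Cell `hodgecm-mathlib`, crux item hLiu418 = `stmt-HodgeConjecture-24832` (helper lane `--kind proof --supports stmt-HodgeConjecture-24832 --as helper`, count-neutral;
closes no socket); squad K2 ∕ K2Liu; LEAD F0P6-plan (g14); F4 lead K2Liu-p27 (g2) (road (E) of record, RULINGS M-158r∕u; WORD 23:13:35Z: «(E-e) SHRINKS to
(i) `vacScalar e (1,(c,d))` BY VALUE, (ii) `κOp (1,k)`-invariance of `binvPi F` ⇔ `linSubst`-invariance of `F` via ★ `κOp_binvPi` + `binvPi` injective, (iii) the
`K̃`-finiteness closure — import the bridge (K2E1-p10's `K2LiuFockPolySubstBridge`), do not re-type it»); desk K2Liu-p10 (g6), box K2E5-r02 (g6); prover K2E3-p23 (g7).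
THEOREMS ONLY (no `def`, no `instance`, no notation, no named-fact hypothesis, no `sorry`).

SETTING (★ Konno–Konno ∕ Segal–Bargmann currency).  Junction datum `U(2,2) × U(R,S)` (`DPIdx (Fin 2) (Fin 2) R S` variables), Schrödinger space
`SR = 𝓢(ℝ^{DPIdx}, ℂ)`, Hermite functions `hermitePi β`, inverse Bargmann map `binvPi : MvPolynomial (DPIdx …) ℂ → SR` (INJECTIVE, ★ `binvPi_injective`;
`binvPi (zeta β) = hermitePi β`), and the operators of the maximal compact `K̃ × K_H = (U(2) × U(2)) × (U(R) × U(S))`: `κOp e k = vacScalar e k • μ₀(dualPairι k)`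
(★ `weilDatum_apply_κ_eq_κOp`: every archimedean Weil datum with vacuum exponents `e` acts on `κ k` by `κOp e k`), `vacScalar e ((a,b),(c,d)) = det a^{e_P} det b^{e_Q}
det c^{e_R} det d^{e_S}` (the vacuum's determinant character — HONEST: on `K_H` it is `det c^{e_R} det d^{e_S}`, in general NOT `1`, so the polynomial of an invariant
vector is det-SEMI-invariant; (i) keeps it BY VALUE).
* §1 «`K̃`-FINITE = POLYNOMIAL × GAUSSIAN»: `span_range_hermitePi_eq_range_binvPiₗ` — the finite Hermite combinations are exactly `range binvPi`
  (`mem_span_range_hermitePi_iff`).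
* §2 (ii) INVARIANCE TRANSFER: `κOp_binvPi_eq_binvPi_iff` — `κOp e k (B⁻¹F) = B⁻¹G ↔ vacScalar e k • linSubst (ι k)^* F = G` (★ `κOp_binvPi` + injectivity);
  `κOp_binvPi_eq_self_iff`; the `K_H`-forms `forall_κOp_one_binvPi_eq_self_iff` and, with (i) the vacuum scalar on `K_H` BY VALUE (`hvac : vacScalar e (1,k₂) = χ k₂`),
  `forall_κOp_one_binvPi_eq_self_iff_of_vacScalar`; for a genuine Weil datum `ω` (★ `IsArchWeilDatum` + vacuum clause) `forall_weilDatum_κ_one_binvPi_eq_self_iff`.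
* §3 (iii) THE HEAD **`exists_binvPi_of_mem_span_hermitePi_of_invariant`** — a `K̃`-finite (`a ∈ span (range hermitePi)`) `K_H`-invariant (`κOp e (1,k₂) a = a`) Schwartz vector
  IS `binvPi F` for a (unique) polynomial `F` with `vacScalar e (1,k₂) • linSubst (dualPairι (1,k₂))^* F = F` for all `k₂` — «= (twisted-)invariant polynomial · φ°»;
  and `κOp_mem_range_binvPi` (the compact operators preserve polynomial × Gaussian).
NOT HERE (other owners, M-158u): the index bridge `linSubst ∘ dualPairι (1,·)` ↔ (E-a0) `polySubst` and «invariants of the product action = products of invariants»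
(`K2LiuFockPolySubstBridge`, K2E1-p10 (g4)); the FFT (E-a2) (K2Liu-p23 (g2)); the value of `vacScalar` on `K_H` for the datum of record (stays BY VALUE, (i)).
References: [Folland1989] §1.6–1.7, Prop. (4.39), §4.2 p. 156; [Howe1989] §3; [KashiwaraVergne1978] §II; [KonnoKonno2007] §3.1.
HONEST LABEL.  Count-neutral helper: `HC_CM` is proved only modulo the 7 printed citations (2 remaining named inputs: hLiu418 = `stmt-HodgeConjecture-24832`, h413 =
`stmt-HodgeConjecture-24833`) until rung 0 closes; this file closes no socket and pays no FFT.
-/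

set_option autoImplicit false
set_option linter.dupNamespace false -- the mandated namespace repeats `HodgeConjecture.HodgeConjecture`

noncomputable section

open scoped MatrixGroups Matrix Topology SchwartzMap ComplexConjugate
open Complex MvPolynomial
open Literature.NumberTheory.Automorphic Literature.Analysis.SegalBargmann Literature.NumberTheory.Weil1964
open Literature.RepresentationTheory.KonnoKonno2007 hiding LetterKind letterOf letterGen letterOf_boost letterOf_torus letterOf_torus_eq
open Literature.RepresentationTheory.KonnoKonno2007.RealDualPair
open Literature.RepresentationTheory.KonnoKonno2007.RealDualPair.UForm
open Summit.HodgeConjecture.HodgeConjecture.Cruxes.HLiu418.K2LiuWeilDatumSmoothU22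
open Summit.HodgeConjecture.HodgeConjecture.Cruxes.HLiu418.K2LiuArchPlaceSecFockDegree

namespace Summit.HodgeConjecture.HodgeConjecture.Cruxes.HLiu418.K2LiuFockInvariantsHermite

/-! ## §1 `K̃`-finite = polynomial × Gaussian (generic index) -/

section Span

variable {ι : Type*} [Fintype ι] [DecidableEq ι]

/-- **The finite Hermite combinations are exactly the polynomial × Gaussian vectors `B⁻¹F`**: `span ℂ (range hermitePi) = range binvPiₗ`
(`hermitePi β = binvPi (zeta β)`; ★ `binvPi_mem_span_hermitePi`). [cite: Folland1989, §1.7] -/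
theorem span_range_hermitePi_eq_range_binvPiₗ :
    Submodule.span ℂ (Set.range (hermitePi (σ := ι))) = LinearMap.range (binvPiₗ (σ := ι)) := by
  apply le_antisymm
  · rw [Submodule.span_le]
    rintro _ ⟨β, rfl⟩
    exact ⟨zeta β, by rw [binvPiₗ_apply, binvPi_zeta]⟩
  · rintro _ ⟨F, rfl⟩
    rw [binvPiₗ_apply]
    refine Submodule.span_mono ?_ (binvPi_mem_span_hermitePi (d := F.totalDegree) le_rfl)
    rintro _ ⟨γ, -, rfl⟩
    exact ⟨γ, rfl⟩

/-- `a` is `K̃`-finite (a finite Hermite combination) iff `a = B⁻¹F` for some polynomial `F`. [cite: Folland1989, §1.7] -/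
theorem mem_span_range_hermitePi_iff (a : 𝓢((ι → ℝ), ℂ)) :
    a ∈ Submodule.span ℂ (Set.range (hermitePi (σ := ι))) ↔ ∃ F : MvPolynomial ι ℂ, binvPi F = a := by
  rw [span_range_hermitePi_eq_range_binvPiₗ, LinearMap.mem_range]
  simp only [binvPiₗ_apply]

end Span

/-! ## §2 (ii) Invariance transfer through the Bargmann map, `vacScalar` by value -/

section Transfer

variable {R S : Type*} [Fintype R] [DecidableEq R] [Fintype S] [DecidableEq S]

/-- **`κOp e k (B⁻¹F) = B⁻¹G ↔ vacScalar e k • (F ∘ (ι k)⁻¹) = G`** (★ `κOp_binvPi`, `binvPi` injective). [cite: Folland1989, Prop. (4.39)] -/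
theorem κOp_binvPi_eq_binvPi_iff (e : VacExponents) (k : DPK (Fin 2) (Fin 2) R S) (F G : MvPolynomial (DPIdx (Fin 2) (Fin 2) R S) ℂ) :
    κOp R S e k (binvPi F) = binvPi G ↔
      vacScalar e k • linSubst (star ((dualPairι k : Matrix.unitaryGroup (DPIdx (Fin 2) (Fin 2) R S) ℂ) :
        Matrix (DPIdx (Fin 2) (Fin 2) R S) (DPIdx (Fin 2) (Fin 2) R S) ℂ)) F = G := by
  rw [κOp_binvPi, binvPi_injective.eq_iff]

/-- **INVARIANCE TRANSFER**: `B⁻¹F` is fixed by `κOp e k` iff `F` is fixed by the TWISTED substitution `vacScalar e k • (· ∘ (ι k)⁻¹)`.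
[cite: Folland1989, Prop. (4.39)] [cite: Howe1989, §3] -/
theorem κOp_binvPi_eq_self_iff (e : VacExponents) (k : DPK (Fin 2) (Fin 2) R S) (F : MvPolynomial (DPIdx (Fin 2) (Fin 2) R S) ℂ) :
    κOp R S e k (binvPi F) = binvPi F ↔
      vacScalar e k • linSubst (star ((dualPairι k : Matrix.unitaryGroup (DPIdx (Fin 2) (Fin 2) R S) ℂ) :
        Matrix (DPIdx (Fin 2) (Fin 2) R S) (DPIdx (Fin 2) (Fin 2) R S) ℂ)) F = F :=
  κOp_binvPi_eq_binvPi_iff e k F F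

/-- **`K_H`-INVARIANCE** (`k = (1, k₂)`, `k₂ ∈ U(R) × U(S)`): `B⁻¹F` is `K_H`-invariant iff `F` is invariant under every twisted `K_H`-substitution.
[cite: Howe1989, §3] [cite: KashiwaraVergne1978, §II] -/
theorem forall_κOp_one_binvPi_eq_self_iff (e : VacExponents) (F : MvPolynomial (DPIdx (Fin 2) (Fin 2) R S) ℂ) :
    (∀ k₂ : Matrix.unitaryGroup R ℂ × Matrix.unitaryGroup S ℂ, κOp R S e ((1, k₂) : DPK (Fin 2) (Fin 2) R S) (binvPi F) = binvPi F) ↔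
      ∀ k₂ : Matrix.unitaryGroup R ℂ × Matrix.unitaryGroup S ℂ,
        vacScalar e ((1, k₂) : DPK (Fin 2) (Fin 2) R S) •
          linSubst (star ((dualPairι ((1, k₂) : DPK (Fin 2) (Fin 2) R S) : Matrix.unitaryGroup (DPIdx (Fin 2) (Fin 2) R S) ℂ) :
            Matrix (DPIdx (Fin 2) (Fin 2) R S) (DPIdx (Fin 2) (Fin 2) R S) ℂ)) F = F :=
  forall_congr' fun k₂ => κOp_binvPi_eq_self_iff e (1, k₂) F

/-- **(i) + (ii): the vacuum scalar on `K_H` BY VALUE.**  If `vacScalar e (1, k₂) = χ k₂` (the datum's determinant character on `K_H`, read by the owner of the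
datum), then `B⁻¹F` is `K_H`-invariant iff `χ k₂ • (F ∘ (ι(1,k₂))⁻¹) = F` for all `k₂` — for `χ = 1` plain invariance. [cite: Folland1989, §4.2 p. 156] [cite: Howe1989, §3] -/
theorem forall_κOp_one_binvPi_eq_self_iff_of_vacScalar (e : VacExponents) (χ : Matrix.unitaryGroup R ℂ × Matrix.unitaryGroup S ℂ → ℂ)
    (hvac : ∀ k₂ : Matrix.unitaryGroup R ℂ × Matrix.unitaryGroup S ℂ, vacScalar e ((1, k₂) : DPK (Fin 2) (Fin 2) R S) = χ k₂)
    (F : MvPolynomial (DPIdx (Fin 2) (Fin 2) R S) ℂ) :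
    (∀ k₂ : Matrix.unitaryGroup R ℂ × Matrix.unitaryGroup S ℂ, κOp R S e ((1, k₂) : DPK (Fin 2) (Fin 2) R S) (binvPi F) = binvPi F) ↔
      ∀ k₂ : Matrix.unitaryGroup R ℂ × Matrix.unitaryGroup S ℂ,
        χ k₂ • linSubst (star ((dualPairι ((1, k₂) : DPK (Fin 2) (Fin 2) R S) : Matrix.unitaryGroup (DPIdx (Fin 2) (Fin 2) R S) ℂ) :
            Matrix (DPIdx (Fin 2) (Fin 2) R S) (DPIdx (Fin 2) (Fin 2) R S) ℂ)) F = F := by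
  rw [forall_κOp_one_binvPi_eq_self_iff]
  refine forall_congr' fun k₂ => ?_
  rw [hvac k₂]

/-- **For a genuine archimedean Weil datum `ω` with vacuum exponents `e`** (★ `weilDatum_apply_κ_eq_κOp`): `ω(κ(1,k₂)) (B⁻¹F) = B⁻¹F` for all `k₂ ∈ K_H` iff `F` is
invariant under every twisted `K_H`-substitution. [cite: Folland1989, Prop. (4.39), §4.2 p. 156] [cite: KonnoKonno2007, §3.1] -/
theorem forall_weilDatum_κ_one_binvPi_eq_self_iff {ω : Representation ℂ (Ginf (Fin 2) (Fin 2) R S) 𝓢((DPIdx (Fin 2) (Fin 2) R S → ℝ), ℂ)}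
    (hW : IsArchWeilDatum (ι𝕎 (Fin 2) (Fin 2) R S) ω) {e : VacExponents}
    (hvac : ∀ k : DPK (Fin 2) (Fin 2) R S, ω (κ (Fin 2) (Fin 2) R S k) (hermitePi 0) = vacScalar e k • hermitePi 0)
    (F : MvPolynomial (DPIdx (Fin 2) (Fin 2) R S) ℂ) :
    (∀ k₂ : Matrix.unitaryGroup R ℂ × Matrix.unitaryGroup S ℂ, ω (κ (Fin 2) (Fin 2) R S (1, k₂)) (binvPi F) = binvPi F) ↔
      ∀ k₂ : Matrix.unitaryGroup R ℂ × Matrix.unitaryGroup S ℂ,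
        vacScalar e ((1, k₂) : DPK (Fin 2) (Fin 2) R S) •
          linSubst (star ((dualPairι ((1, k₂) : DPK (Fin 2) (Fin 2) R S) : Matrix.unitaryGroup (DPIdx (Fin 2) (Fin 2) R S) ℂ) :
            Matrix (DPIdx (Fin 2) (Fin 2) R S) (DPIdx (Fin 2) (Fin 2) R S) ℂ)) F = F := by
  refine forall_congr' fun k₂ => ?_
  rw [weilDatum_apply_κ_eq_κOp hW hvac, κOp_binvPi_eq_self_iff]

/-! ## §3 (iii) The head: a `K̃`-finite `K_H`-invariant Schwartz vector is a twisted-invariant polynomial × Gaussian -/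

/-- **The compact operators preserve polynomial × Gaussian** (`K̃`-finiteness is `κOp`-stable): `κOp e k (B⁻¹F) = B⁻¹F′`. [cite: Folland1989, Prop. (4.39)] -/
theorem κOp_mem_range_binvPi (e : VacExponents) (k : DPK (Fin 2) (Fin 2) R S) (F : MvPolynomial (DPIdx (Fin 2) (Fin 2) R S) ℂ) :
    ∃ F' : MvPolynomial (DPIdx (Fin 2) (Fin 2) R S) ℂ, binvPi F' = κOp R S e k (binvPi F) :=
  ⟨_, (κOp_binvPi e k F).symm⟩

/-- **(E-e) HEAD — «`K̃`-FINITE + `K_H`-INVARIANT SCHWARTZ VECTOR = TWISTED-INVARIANT POLYNOMIAL · φ°»**: if `a` is a finite Hermite combination and is fixed by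
every `κOp e (1, k₂)`, `k₂ ∈ U(R) × U(S)`, then `a = B⁻¹F` for a polynomial `F` with `vacScalar e (1,k₂) • (F ∘ (ι(1,k₂))⁻¹) = F` for all `k₂` (unique by ★
`binvPi_injective`).  With (i) `vacScalar = 1` on `K_H` this is plain `K_H`-invariance of `F`, the input of the bridge (K2E1-p10) and the FFT (E-a2).
[cite: Howe1989, §3] [cite: KashiwaraVergne1978, §II] [cite: Folland1989, Prop. (4.39)] -/
theorem exists_binvPi_of_mem_span_hermitePi_of_invariant (e : VacExponents) {a : 𝓢((DPIdx (Fin 2) (Fin 2) R S → ℝ), ℂ)}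
    (hfin : a ∈ Submodule.span ℂ (Set.range (hermitePi (σ := DPIdx (Fin 2) (Fin 2) R S))))
    (hinv : ∀ k₂ : Matrix.unitaryGroup R ℂ × Matrix.unitaryGroup S ℂ, κOp R S e ((1, k₂) : DPK (Fin 2) (Fin 2) R S) a = a) :
    ∃ F : MvPolynomial (DPIdx (Fin 2) (Fin 2) R S) ℂ, binvPi F = a ∧
      ∀ k₂ : Matrix.unitaryGroup R ℂ × Matrix.unitaryGroup S ℂ,
        vacScalar e ((1, k₂) : DPK (Fin 2) (Fin 2) R S) •
          linSubst (star ((dualPairι ((1, k₂) : DPK (Fin 2) (Fin 2) R S) : Matrix.unitaryGroup (DPIdx (Fin 2) (Fin 2) R S) ℂ) :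
            Matrix (DPIdx (Fin 2) (Fin 2) R S) (DPIdx (Fin 2) (Fin 2) R S) ℂ)) F = F := by
  obtain ⟨F, rfl⟩ := (mem_span_range_hermitePi_iff a).1 hfin
  exact ⟨F, rfl, (forall_κOp_one_binvPi_eq_self_iff e F).1 hinv⟩

/-- The same with the vacuum scalar on `K_H` BY VALUE (`hvac : vacScalar e (1,k₂) = χ k₂`). [cite: Folland1989, §4.2 p. 156] [cite: Howe1989, §3] -/
theorem exists_binvPi_of_mem_span_hermitePi_of_invariant_of_vacScalar (e : VacExponents) (χ : Matrix.unitaryGroup R ℂ × Matrix.unitaryGroup S ℂ → ℂ)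
    (hvac : ∀ k₂ : Matrix.unitaryGroup R ℂ × Matrix.unitaryGroup S ℂ, vacScalar e ((1, k₂) : DPK (Fin 2) (Fin 2) R S) = χ k₂)
    {a : 𝓢((DPIdx (Fin 2) (Fin 2) R S → ℝ), ℂ)}
    (hfin : a ∈ Submodule.span ℂ (Set.range (hermitePi (σ := DPIdx (Fin 2) (Fin 2) R S))))
    (hinv : ∀ k₂ : Matrix.unitaryGroup R ℂ × Matrix.unitaryGroup S ℂ, κOp R S e ((1, k₂) : DPK (Fin 2) (Fin 2) R S) a = a) :
    ∃ F : MvPolynomial (DPIdx (Fin 2) (Fin 2) R S) ℂ, binvPi F = a ∧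
      ∀ k₂ : Matrix.unitaryGroup R ℂ × Matrix.unitaryGroup S ℂ,
        χ k₂ • linSubst (star ((dualPairι ((1, k₂) : DPK (Fin 2) (Fin 2) R S) : Matrix.unitaryGroup (DPIdx (Fin 2) (Fin 2) R S) ℂ) :
            Matrix (DPIdx (Fin 2) (Fin 2) R S) (DPIdx (Fin 2) (Fin 2) R S) ℂ)) F = F := by
  obtain ⟨F, rfl⟩ := (mem_span_range_hermitePi_iff a).1 hfin
  exact ⟨F, rfl, (forall_κOp_one_binvPi_eq_self_iff_of_vacScalar e χ hvac F).1 hinv⟩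

end Transfer

end Summit.HodgeConjecture.HodgeConjecture.Cruxes.HLiu418.K2LiuFockInvariantsHermite

end
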